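import Literature.NumberTheory.Rogawski1990.ArchBouazizClassDescent       -- ★ p851524 (this seat): `exists_classDescent_of_section_of_descent` ((Σ4c-asm) modulo (sec)+(desc))
import Literature.NumberTheory.Rogawski1990.ArchBouazizChartDescent       -- ★ p851530∕p851534 (this seat ∕ LH3-p03 (g6)): `div_eq_div_of_bzClassMap_eq` ((Σ4c-desc))
import Literature.NumberTheory.Rogawski1990.ArchBouazizClassMapSection    -- ★ p851561 (LH3-p03 (g6)): `exists_contDiffOn_section_bzClassMap(₃)` ((Σ4c-sec), explicit section on the image; over ★ p851556)
import HarnessLib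

/-!
# (Σ4c) DESCENT THROUGH THE STABLE-CLASS MAP AT A REGULAR CHART POINT — PAID: F0P3a-p04's (Σ-REG) interface `exists_classDescent` by bare names
# (L3′ SURJ road, organ (Σ-REG); Bouaziz 1994 §5.1, Varadarajan 1989 §6 p. 229)

Topic `NumberTheory/Rogawski1990`; namespace `Literature.NumberTheory.Rogawski1990`.  THEOREMS ONLY (no `def`, no instance, no axiom, no `sorry`).  Cell `pub/hodgecm-mathlib`,
crux H413 (`stmt-HodgeConjecture-24833`), line LH3 (closer stub `stub_N9`), letter L3′, SURJ-OF-FORWARD road (binder LH10-p01 (g5)), organ (Σ-REG) (interface binder F0P3a-p04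
(g25), interface text 12:51:49Z (2), ROUTING OF RECORD 13:02Z).  Author LH10-p02 (g7).  Count-neutral.

WHAT.  **`exists_classDescent`** = p04's (Σ4c) interface, token for token: near a regular chart point `c₀` of the chart `S`, for a (P)(W)(X)-covariant `Φ` smooth on `InRegS S` and
non-zero on the `ε₀`-class-neighbourhood, ONE `ε ∈ (0, ε₀]` such that every (P)(W)(X)-covariant `Ψ` smooth on `InRegS S` descends to `F ∈ C^∞(W → ℂ × ℂ × ℂ)` with
`F (bzClassMap S c) · Φ c = Ψ c` for `c ∈ RegS S`, `dist (bzClassMap S c) (bzClassMap S c₀) < ε`.  One line over ★ (Σ4c-asm) `exists_classDescent_of_section_of_descent` with (sec) := ★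
`exists_contDiffOn_section_bzClassMap₃` (LH3-p03; the 3-clause corollary of his 4-clause head) and (desc) := ★ `div_eq_div_of_bzClassMap_eq`.
HONEST LABEL: L3′ stays XL∕PRINT-labelled ((Σ-WALL) PRINT, RULING #23) until paid; HC_CM is proved only modulo the 7 printed citations (2 remaining: hLiu418 =
stmt-HodgeConjecture-24832, h413 = stmt-HodgeConjecture-24833) until rung 0 closes; pays nothing by itself.

## References
* [Bouaziz1994IntegralesOrbitales] A. Bouaziz, *Intégrales orbitales sur les groupes de Lie réductifs*, Ann. Sci. ÉNS (4) 27 (1994), §5.1 p. 588.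
* [Varadarajan1989] V. S. Varadarajan, *An Introduction to Harmonic Analysis on Semisimple Lie Groups* (1989), §6 p. 229.
-/

set_option autoImplicit false

noncomputable section

open Complex Set Function Real Metric
open scoped ContDiff
open Literature.NumberTheory.Automorphic.ArchCartan

namespace Literature.NumberTheory.Rogawski1990

variable {W : Type*} [Fintype W] [DecidableEq W]

/-- **(Σ4c) DESCENT THROUGH THE CLASS MAP — F0P3a-p04's (Σ-REG) interface, PAID.** [cite: Bouaziz1994IntegralesOrbitales, §5.1 p. 588] [cite: Varadarajan1989, §6 p. 229] -/
theorem exists_classDescent (S : Finset W) {c₀ : W → Fin 3 → ℝ} (hc₀ : c₀ ∈ RegS S) (Φ : (W → Fin 3 → ℝ) → ℂ) {ε₀ : ℝ} (hε₀ : 0 < ε₀)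
    (hΦP : ∀ (c : W → Fin 3 → ℝ) (w : W) (i : Fin 3) (k : ℤ), (w ∉ S ∨ i ≠ 0) → Φ (c + angleShift w i k) = Φ c)
    (hΦW : ∀ (c : W → Fin 3 → ℝ) (w : W), w ∉ S → Φ (flipAt w c) * archRH S c = archRH S (flipAt w c) * Φ c)
    (hΦX : ∀ (c : W → Fin 3 → ℝ) (w : W), w ∈ S → Φ (negXAt w c) = Φ c)
    (hΦs : ContDiffOn ℝ ∞ Φ (InRegS S)) (hΦ0 : ∀ c ∈ RegS S, dist (bzClassMap S c) (bzClassMap S c₀) < ε₀ → Φ c ≠ 0) :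
    ∃ ε : ℝ, 0 < ε ∧ ε ≤ ε₀ ∧ ∀ Ψ : (W → Fin 3 → ℝ) → ℂ,
      (∀ (c : W → Fin 3 → ℝ) (w : W) (i : Fin 3) (k : ℤ), (w ∉ S ∨ i ≠ 0) → Ψ (c + angleShift w i k) = Ψ c) →
      (∀ (c : W → Fin 3 → ℝ) (w : W), w ∉ S → Ψ (flipAt w c) * archRH S c = archRH S (flipAt w c) * Ψ c) →
      (∀ (c : W → Fin 3 → ℝ) (w : W), w ∈ S → Ψ (negXAt w c) = Ψ c) →
      ContDiffOn ℝ ∞ Ψ (InRegS S) →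
        ∃ F : (W → ℂ × ℂ × ℂ) → ℂ, ContDiff ℝ ∞ F ∧ ∀ c ∈ RegS S, dist (bzClassMap S c) (bzClassMap S c₀) < ε → F (bzClassMap S c) * Φ c = Ψ c := by
  exact exists_classDescent_of_section_of_descent S hc₀ Φ hε₀ hΦs hΦ0 (exists_contDiffOn_section_bzClassMap₃ S hc₀)
    (fun Ψ hP hW hX => div_eq_div_of_bzClassMap_eq S hP hW hX hΦP hΦW hΦX)

end Literature.NumberTheory.Rogawski1990

end
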